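import Mathlib
import Summits.ValiantsHypothesis.ValiantsHypothesis.Theorems.GrenetZeonTwoDimCoefficientsGradedHessianPivots

/-!
# Crux `GrenetZeon.TwoDimCoefficients` (stmt-ValiantsHypothesis-8062) / rung `DualUnipotentThreeHalves` (stmt-24318):
# ★★★ THEOREM T7 — the HESSIAN-RATE LAW for consecutive-graded pencils of ANY nil-index (kernel plan step 5a)

Memo TWENTY-SECOND HAND §2.  For an affine pencil `N` that is consecutive-level graded for some `lvl : Fin m → ℕ`
(`N a b ≠ 0 ⇒ lvl b = lvl a + 1`), an affine `M`, `n ≥ 4`, `n − 1 < m`, and EVERY point `p`: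

  `rank Hess_p tr(N^{n−1}·M) · ⌊n/4⌋ ≤ 12·m²`.

This is conjecture (H) `HessianRate` of the route's plan of record on the whole consecutive-graded class — no bound on the
nil-index of `N` (the chain may be arbitrarily long), no per-genericity, no substitution.  Proof = coordinated pivots: shift the
levels by `L = ⌊n/4⌋`, cut them into segments of length `L`, take as pivot of each segment a level of minimum width
(`L·w_{P k} ≤ mass of segment k`), give slot `s` (segment `k ≥ 1`) the pivots `(P (k−1), P (k+2))` — admissible because
`4L ≤ n` — apply ✓ `rank_hess0_graded_le_of_pivots`, and do the banded accounting
`2L·Σ_s B_s ≤ Σ_j 2·[A_{j+1}A_{j+3} + (A_{j+1}+A_{j+2})(A_j+A_{j+3})] ≤ 12·Σ_j A_j² ≤ 12·(Σ_j A_j)² ≤ 12·m²`.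

* `sum_range_mul` / `sum_sq_le_sq_sum` / `sum_card_level_le` — bookkeeping;
* ★★★ `rank_hess0_graded_mul_le` — the law above.

HONEST FRAMING: unconditional for consecutive-graded pencils; block-triangular pencils with non-zero diagonal classes, long jumps,
and wild constituents are NOT covered (memo §5); the stub `DualUnipotentBound`, crux 8062, the 24318 decl in general and
`VP ≠ VNP` remain open.

References: folklore linear algebra.
-/

set_option linter.dupNamespace false
set_option autoImplicit false

noncomputable section

namespace Summit.ValiantsHypothesis.ValiantsHypothesis.Theorems.GrenetZeonTwoDimCoefficients.GradedHessianRate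

open Module Matrix MvPolynomial
open Literature.Computability.AlgebraicComplexity
open Summit.ValiantsHypothesis.ValiantsHypothesis.Cruxes.TwoDimCoefficients.DimTwoCases (AffMat IsAffine)
open Summit.ValiantsHypothesis.ValiantsHypothesis.Theorems.GrenetZeonTwoDimCoefficients.GradedHessianPivots
  (rank_hess0_graded_le_of_pivots)

/-! ### Arithmetic bookkeeping -/

/-- `Σ_{s < J·L} f s = Σ_{j<J} Σ_{i<L} f (j·L + i)`. [folklore] -/
theorem sum_range_mul (f : ℕ → ℕ) (J L : ℕ) :
    ∑ s ∈ Finset.range (J * L), f s = ∑ j ∈ Finset.range J, ∑ i ∈ Finset.range L, f (j * L + i) := by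
  induction J with
  | zero => simp
  | succ J ih => rw [Nat.succ_mul, Finset.sum_range_add, ih, Finset.sum_range_succ]

/-- `Σ f² ≤ (Σ f)²` over `ℕ`. [folklore] -/
theorem sum_sq_le_sq_sum {ι : Type*} (s : Finset ι) (f : ι → ℕ) :
    ∑ i ∈ s, f i ^ 2 ≤ (∑ i ∈ s, f i) ^ 2 := by
  rw [sq, Finset.sum_mul_sum]
  refine Finset.sum_le_sum fun i hi => ?_
  rw [sq]
  exact Finset.single_le_sum (f := fun j => f i * f j) (fun j _ => Nat.zero_le _) hi

/-- A shifted partial sum is dominated by a longer one: `Σ_{j<J} g (j+t) ≤ Σ_{j<J+t} g j`. [folklore] -/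
theorem sum_range_shift_le (g : ℕ → ℕ) (J t : ℕ) :
    ∑ j ∈ Finset.range J, g (j + t) ≤ ∑ j ∈ Finset.range (J + t), g j := by
  rw [add_comm J t, Finset.sum_range_add]
  simp_rw [add_comm _ t]
  exact Nat.le_add_left _ _

/-- The level widths sum to at most `m`: `Σ_{s<T} #{i : lvl i = s} ≤ m`. [folklore] -/
theorem sum_card_level_le {m : ℕ} (lvl : Fin m → ℕ) (T : ℕ) :
    ∑ s ∈ Finset.range T, Fintype.card {i : Fin m // lvl i = s} ≤ m := by
  classical
  simp_rw [Fintype.card_subtype]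
  rw [Finset.sum_card_fiberwise_eq_card_filter]
  exact (Finset.card_filter_le _ _).trans (by simp)

/-- The elementary inequality of the banded accounting:
`2·[a₁a₃ + (a₁+a₂)(a₀+a₃)] ≤ 3·(a₀² + a₁² + a₂² + a₃²)`. [folklore] -/
theorem two_mul_band_le (a₀ a₁ a₂ a₃ : ℕ) :
    2 * (a₁ * a₃ + (a₁ + a₂) * (a₀ + a₃)) ≤ 3 * (a₀ ^ 2 + a₁ ^ 2 + a₂ ^ 2 + a₃ ^ 2) := by
  nlinarith [sq_nonneg ((a₁ : ℤ) - a₃), sq_nonneg ((a₁ : ℤ) - a₀), sq_nonneg ((a₂ : ℤ) - a₀),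
    sq_nonneg ((a₂ : ℤ) - a₃), sq_nonneg ((a₀ : ℤ)), sq_nonneg ((a₃ : ℤ) - a₁), sq_nonneg (a₀ + a₁ + a₂ + a₃)]

/-! ### The law -/

variable {n m : ℕ}

/-- ★★★ **Hessian-rate law for consecutive-graded pencils (Theorem T7).**  `N` affine and consecutive-level graded for
`lvl`, `M` affine, `4 ≤ n`, `n − 1 < m`: at every point `p`, `rank Hess_p tr(N^{n−1}·M) · ⌊n/4⌋ ≤ 12·m²`. [folklore] -/
theorem rank_hess0_graded_mul_le (lvl : Fin m → ℕ) (N M : AffMat n m) (hN : IsAffine N) (hM : IsAffine M)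
    (hgr : ∀ a b, lvl b ≠ lvl a + 1 → N a b = 0) (hn : 4 ≤ n) (hnm : n - 1 < m) (p : Fin n × Fin n → ℂ) :
    (hess0 (transl p ((N ^ (n - 1) * M).trace))).rank * (n / 4) ≤ 12 * m ^ 2 := by
  classical
  -- segment length and shifted levels
  set L : ℕ := n / 4 with hL
  have hL1 : 1 ≤ L := by omega
  have hL4 : 4 * L ≤ n := by omega
  set lvl' : Fin m → ℕ := fun i => lvl i + L with hlvl'
  have hgr' : ∀ a b, lvl' b ≠ lvl' a + 1 → N a b = 0 := fun a b h => hgr a b (by simp only [hlvl'] at h; omega)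
  -- widths
  set w : ℕ → ℕ := fun q => Fintype.card {i : Fin m // lvl' i = q} with hw
  have hw0 : ∀ q, q < L → w q = 0 := by
    intro q hq
    simp only [hw, Fintype.card_eq_zero_iff]
    exact ⟨fun i => absurd i.2 (by simp only [hlvl']; omega)⟩
  -- a level bound
  obtain ⟨H, hH⟩ : ∃ H, ∀ i, lvl' i < H :=
    ⟨Finset.univ.sup lvl' + 1, fun i => Nat.lt_succ_of_le (Finset.le_sup (f := lvl') (Finset.mem_univ i))⟩
  -- segment masses and pivots of minimum width
  set A : ℕ → ℕ := fun k => ∑ i ∈ Finset.range L, w (k * L + i) with hA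
  have hP : ∀ k, ∃ q, q ∈ Finset.Ico (k * L) (k * L + L) ∧ ∀ q' ∈ Finset.Ico (k * L) (k * L + L), w q ≤ w q' := by
    intro k
    obtain ⟨q, hq, hmin⟩ := Finset.exists_min_image (Finset.Ico (k * L) (k * L + L)) w
      ⟨k * L, Finset.mem_Ico.mpr ⟨le_rfl, by omega⟩⟩
    exact ⟨q, hq, hmin⟩
  choose P hPmem hPmin using hP
  have hPlo : ∀ k, k * L ≤ P k := fun k => (Finset.mem_Ico.mp (hPmem k)).1
  have hPhi : ∀ k, P k < k * L + L := fun k => (Finset.mem_Ico.mp (hPmem k)).2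
  have hPA : ∀ k, L * w (P k) ≤ A k := by
    intro k
    have h1 : A k = ∑ q ∈ Finset.Ico (k * L) (k * L + L), w q := by
      rw [hA, Finset.sum_Ico_eq_sum_range]
      simp
    have h2 := Finset.card_nsmul_le_sum (Finset.Ico (k * L) (k * L + L)) w (w (P k)) fun q hq => hPmin k q hq
    rw [Nat.card_Ico, smul_eq_mul, show k * L + L - k * L = L by omega] at h2
    rw [h1]
    exact h2
  -- the pivot assignment
  have hrank := rank_hess0_graded_le_of_pivots lvl' N M hN hM hgr' hnm H hH p
    (fun s => P (s / L - 1)) (fun s => P (s / L + 2)) (fun s => L ≤ s) (by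
      intro s hs
      obtain ⟨k', hk'⟩ : ∃ k', s / L = k' + 1 := ⟨s / L - 1, by
        have : 1 ≤ s / L := (Nat.le_div_iff_mul_le hL1).mpr (by simpa using hs); omega⟩
      have hsl : s / L * L ≤ s := Nat.div_mul_le_self s L
      have hsu : s < s / L * L + L := Nat.lt_div_mul_add hL1
      rw [hk'] at hsl hsu ⊢
      simp only [Nat.add_sub_cancel, show k' + 1 + 2 = k' + 3 by ring]
      have e1 : (k' + 1) * L = k' * L + L := by ring
      have e3 : (k' + 3) * L = k' * L + 3 * L := by ring
      have f1 : k' * L + L ≤ s := by linarith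
      have f2 : s < k' * L + L + L := by linarith
      have f3 : P k' < k' * L + L := hPhi k'
      have f4 : k' * L ≤ P k' := hPlo k'
      have f5 : k' * L + 3 * L ≤ P (k' + 3) := by have := hPlo (k' + 3); linarith
      have f6 : P (k' + 3) < k' * L + 3 * L + L := by have := hPhi (k' + 3); linarith
      refine ⟨by omega, by omega, by omega⟩)
  -- the per-slot bounds
  set B : ℕ → ℕ := fun ℓ => if L ≤ ℓ then w ℓ * w (P (ℓ / L + 2)) + w (ℓ + 1) * (w (P (ℓ / L - 1)) + w (P (ℓ / L + 2)))
    else w (ℓ + 1) * w ℓ with hB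
  have hrank' : (hess0 (transl p ((N ^ (n - 1) * M).trace))).rank ≤ 2 * ∑ ℓ ∈ Finset.range H, B ℓ := hrank
  -- (i) extend the slot range to whole segments: `H ≤ (H+1)·L`
  have hext : ∑ ℓ ∈ Finset.range H, B ℓ ≤ ∑ ℓ ∈ Finset.range ((H + 1) * L), B ℓ :=
    Finset.sum_le_sum_of_subset (Finset.range_mono (by nlinarith))
  -- (ii) segment by segment; the first segment is empty
  have hB0 : ∀ i ∈ Finset.range L, B (0 * L + i) = 0 := by
    intro i hi
    rw [Finset.mem_range] at hi
    simp only [hB, zero_mul, zero_add, if_neg (not_le.mpr hi), hw0 i hi, mul_zero]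
  have hseg : ∑ ℓ ∈ Finset.range ((H + 1) * L), B ℓ =
      ∑ j ∈ Finset.range H, ∑ i ∈ Finset.range L, B ((j + 1) * L + i) := by
    rw [sum_range_mul, Finset.sum_range_succ', Finset.sum_eq_zero hB0, add_zero]
  -- (iii) one segment
  have hone : ∀ j, L * ∑ i ∈ Finset.range L, B ((j + 1) * L + i) ≤
      A (j + 1) * A (j + 3) + (A (j + 1) + A (j + 2)) * (A j + A (j + 3)) := by
    intro j
    have hdiv : ∀ i ∈ Finset.range L, ((j + 1) * L + i) / L = j + 1 := by
      intro i hi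
      rw [Finset.mem_range] at hi
      rw [add_comm, Nat.add_mul_div_right _ _ (by omega), Nat.div_eq_of_lt hi, zero_add]
    have hBi : ∀ i ∈ Finset.range L, B ((j + 1) * L + i) =
        w ((j + 1) * L + i) * w (P (j + 3)) + w ((j + 1) * L + i + 1) * (w (P j) + w (P (j + 3))) := by
      intro i hi
      have hle : L ≤ (j + 1) * L + i := by nlinarith
      simp only [hB, if_pos hle, hdiv i hi, Nat.add_sub_cancel]
    rw [Finset.sum_congr rfl hBi, Finset.sum_add_distrib, ← Finset.sum_mul, ← Finset.sum_mul]
    -- the shifted width sum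
    have hshift : ∑ i ∈ Finset.range L, w ((j + 1) * L + i + 1) ≤ A (j + 1) + A (j + 2) := by
      have e : ∑ i ∈ Finset.range (L + 1), w ((j + 1) * L + i) =
          ∑ i ∈ Finset.range L, w ((j + 1) * L + i + 1) + w ((j + 1) * L + 0) := by
        rw [Finset.sum_range_succ']
        simp_rw [add_assoc]
      have e2 : ∑ i ∈ Finset.range (L + 1), w ((j + 1) * L + i) = A (j + 1) + w ((j + 1) * L + L) := by
        rw [Finset.sum_range_succ]
      have e3 : w ((j + 1) * L + L) ≤ A (j + 2) := by
        have : (j + 1) * L + L = (j + 2) * L + 0 := by ring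
        rw [this, hA]
        exact Finset.single_le_sum (f := fun i => w ((j + 2) * L + i)) (fun i _ => Nat.zero_le _)
          (Finset.mem_range.mpr (by omega))
      omega
    have hA1 : ∑ i ∈ Finset.range L, w ((j + 1) * L + i) = A (j + 1) := rfl
    rw [hA1]
    have k1 := hPA j
    have k3 := hPA (j + 3)
    calc L * (A (j + 1) * w (P (j + 3)) + (∑ i ∈ Finset.range L, w ((j + 1) * L + i + 1)) * (w (P j) + w (P (j + 3))))
        ≤ L * (A (j + 1) * w (P (j + 3)) + (A (j + 1) + A (j + 2)) * (w (P j) + w (P (j + 3)))) := by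
          gcongr
      _ = A (j + 1) * (L * w (P (j + 3))) + (A (j + 1) + A (j + 2)) * (L * w (P j) + L * w (P (j + 3))) := by ring
      _ ≤ A (j + 1) * A (j + 3) + (A (j + 1) + A (j + 2)) * (A j + A (j + 3)) := by gcongr
  -- (iv) sum the segments
  have hmass : ∑ j ∈ Finset.range (H + 3), A j ≤ m := by
    have : ∑ j ∈ Finset.range (H + 3), A j = ∑ s ∈ Finset.range ((H + 3) * L), w s := by
      rw [sum_range_mul]
    rw [this]
    exact sum_card_level_le lvl' _
  have hacc : 2 * (L * ∑ ℓ ∈ Finset.range H, B ℓ) ≤ 12 * m ^ 2 := by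
    calc 2 * (L * ∑ ℓ ∈ Finset.range H, B ℓ)
        ≤ 2 * (L * ∑ j ∈ Finset.range H, ∑ i ∈ Finset.range L, B ((j + 1) * L + i)) := by
          rw [← hseg]; gcongr
      _ = ∑ j ∈ Finset.range H, 2 * (L * ∑ i ∈ Finset.range L, B ((j + 1) * L + i)) := by
          rw [Finset.mul_sum, Finset.mul_sum]
      _ ≤ ∑ j ∈ Finset.range H, 3 * (A j ^ 2 + A (j + 1) ^ 2 + A (j + 2) ^ 2 + A (j + 3) ^ 2) :=
          Finset.sum_le_sum fun j _ => (Nat.mul_le_mul_left 2 (hone j)).trans (two_mul_band_le _ _ _ _)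
      _ = 3 * (∑ j ∈ Finset.range H, A (j + 0) ^ 2 + ∑ j ∈ Finset.range H, A (j + 1) ^ 2 +
            ∑ j ∈ Finset.range H, A (j + 2) ^ 2 + ∑ j ∈ Finset.range H, A (j + 3) ^ 2) := by
          rw [← Finset.mul_sum]
          simp only [add_zero, Finset.sum_add_distrib]
      _ ≤ 3 * (∑ j ∈ Finset.range (H + 3), A j ^ 2 + ∑ j ∈ Finset.range (H + 3), A j ^ 2 +
            ∑ j ∈ Finset.range (H + 3), A j ^ 2 + ∑ j ∈ Finset.range (H + 3), A j ^ 2) := by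
          gcongr <;>
            exact (sum_range_shift_le (fun j => A j ^ 2) H _).trans
              (Finset.sum_le_sum_of_subset (Finset.range_mono (by omega)))
      _ = 12 * ∑ j ∈ Finset.range (H + 3), A j ^ 2 := by ring
      _ ≤ 12 * (∑ j ∈ Finset.range (H + 3), A j) ^ 2 := Nat.mul_le_mul_left 12 (sum_sq_le_sq_sum _ _)
      _ ≤ 12 * m ^ 2 := Nat.mul_le_mul_left 12 (Nat.pow_le_pow_left hmass 2)
  -- (v) conclude
  calc (hess0 (transl p ((N ^ (n - 1) * M).trace))).rank * (n / 4)
      ≤ (2 * ∑ ℓ ∈ Finset.range H, B ℓ) * L := Nat.mul_le_mul_right L hrank'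
    _ = 2 * (L * ∑ ℓ ∈ Finset.range H, B ℓ) := by ring
    _ ≤ 12 * m ^ 2 := hacc

end Summit.ValiantsHypothesis.ValiantsHypothesis.Theorems.GrenetZeonTwoDimCoefficients.GradedHessianRate

end
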